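import Mathlib.Analysis.Normed.Module.Ball.Pointwise
import Literature.Topology.FourManifolds.MMSWRasmussenFacts
import Literature.Topology.FourManifolds.MMSWFibreRotation
import Literature.Topology.FourManifolds.BallStretch
import Literature.Topology.FourManifolds.FramedTubularNbhd
import Literature.Topology.FourManifolds.WhitneyModelSheets
import Summits.SmoothPoincare4.SmoothPoincare4.Theses.DottedCircleRasmussen

/-!
# Helper `helper_handlebodyChart_zero` (the `k = 0` instance of stub `stub_handlebodyChart`)
of line `mk_friends` for crux `DcrGap`
(item stmt-SmoothPoincare4-16128, route route-SmoothPoincare4-DottedCircleRasmussen)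

**Every germ chart of the model `0`-handlebody `D_0` extends to a global chart.**  With no
`1`-handles the model dotted handlebody `MMSW.modelHandlebody 0` is the solid ellipsoid
`D_0 = {(x₀² + x₁²)/40² + x₂² + x₃² ≤ 1} ⊂ ℝ⁴`, the per-handle twist `τ^ε` is the identity (empty
product of multipliers), and the statement of the stub reads: if `i : ℝ⁴ → X` is smooth, injective
and immersive on an open `U ⊇ D_0` (`X` any smooth `4`-manifold), then some smooth embedding
`e : ℝ⁴ → X` (`Manifold.IsSmoothEmbedding`) agrees with `i` on `D_0`.

Proof.  The axis scaling `A (x₀, x₁, x₂, x₃) = (x₀/40, x₁/40, x₂, x₃)` carries `D_0` onto the closed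
unit ball, and `A⁻¹ ⁻¹' U ⊇ B̄(0, 1)` is open, so it contains `B(0, R)` for some `R > 1`
(`IsCompact.exists_thickening_subset_open`, `thickening_closedBall`).  The tree's ball stretch
`ballStretch R : ℝ⁴ → B(0, R)` (`BallStretch.lean`: a diffeomorphism onto the open ball which is the
identity on `B̄(0, 1)`) conjugated by `A` is a smooth injective self-map `ψ` of `ℝ⁴` with injective
derivative, with values in `U`, and equal to the identity on `D_0`; put `e := i ∘ ψ`.  Then `e` is
smooth, injective, with injective `mfderiv` everywhere (chain rule), hence a local diffeomorphism
(inverse function theorem, `isLocalDiffeomorphAt_of_mfderiv_injective`) and so a smooth embedding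
(`isSmoothEmbedding_of_isLocalDiffeomorph`), and `e = i` on `D_0`.

No named facts, no `sorry`.  References: M. W. Hirsch, *Differential Topology* (1976), Ch. 8
(radial isotopies) [Hirsch1976]; J. M. Lee, *Introduction to Smooth Manifolds* (2013), Thm. 4.5,
Prop. 5.2 [LeeSmoothManifolds2013].
-/

-- the prescribed namespace `Summit.<P>.<Sub>.…` duplicates `SmoothPoincare4` (P = Sub)
set_option linter.dupNamespace false

noncomputable section

open scoped Manifold ContDiff Topology
open Function Set Metric
open Literature.Topology.FourManifolds Literature.Topology.FourManifolds.MMSW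

namespace Summit.SmoothPoincare4.SmoothPoincare4.Theorems.DcrGap.MkFriends

/-! ## The axis scaling carrying `D_0` onto the unit ball -/

/-- **The axis scaling.**  There is a continuous linear automorphism `A` of `ℝ⁴` — namely
`A (x₀, x₁, x₂, x₃) = (x₀/40, x₁/40, x₂, x₃)` — with `‖A x‖² = G_0(x)`, the level function of the
model `0`-handlebody; so `A` carries `D_0 = {G_0 ≤ 1}` onto the closed unit ball.  (Stated as an
existence so that no definition is introduced.) [folklore] -/
theorem handlebodyChart_exists_scaling :
    ∃ A : EuclideanSpace ℝ (Fin 4) ≃L[ℝ] EuclideanSpace ℝ (Fin 4),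
      ∀ x, ‖A x‖ ^ 2 = levelFun 0 x := by
  refine ⟨LinearEquiv.toContinuousLinearEquiv
    { toFun := fun x => !₂[x 0 / 40, x 1 / 40, x 2, x 3]
      map_add' := fun x y => by ext i; fin_cases i <;> simp <;> ring
      map_smul' := fun c x => by ext i; fin_cases i <;> simp <;> ring
      invFun := fun y => !₂[40 * y 0, 40 * y 1, y 2, y 3]
      left_inv := fun x => by ext i; fin_cases i <;> simp <;> ring
      right_inv := fun y => by ext i; fin_cases i <;> simp [mul_div_cancel_left₀] }, fun x => ?_⟩
  show ‖(!₂[x 0 / 40, x 1 / 40, x 2, x 3] : EuclideanSpace ℝ (Fin 4))‖ ^ 2 = levelFun 0 x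
  rw [EuclideanSpace.real_norm_sq_eq, Fin.sum_univ_four]
  simp [levelFun]
  ring

/-! ## The `k = 0` handlebody chart -/

/-- **Helper `helper_handlebodyChart_zero`** — literally the `k = 0` instance of the registered
stub `stub_handlebodyChart`: in any smooth `4`-manifold `X`, a germ chart `i` of the solid ellipsoid
`D_0 = MMSW.modelHandlebody 0` (smooth, injective and immersive on an open `U ⊇ D_0`) agrees on
`D_0` with a global smooth embedding `e : ℝ⁴ → X`; the twist `τ^ε` over `Fin 0` is the identity.
Proof: `e = i ∘ A⁻¹ ∘ ballStretch R ∘ A` with `A` the axis scaling (`handlebodyChart_exists_scaling`)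
and `R > 1` such that `B(0, R) ⊆ A (U)`.
[cite: Hirsch1976, Ch. 8 §1] -/
theorem helper_handlebodyChart_zero : ∀ (X : Type) [TopologicalSpace X] [T2Space X] [SecondCountableTopology X] [ChartedSpace (EuclideanSpace ℝ (Fin 4)) X] [IsManifold (𝓡 4) ((⊤ : ℕ∞) : WithTop ℕ∞) X], SimplyConnectedSpace X → ∀ (U : Set (EuclideanSpace ℝ (Fin 4))) (i : EuclideanSpace ℝ (Fin 4) → X), (IsOpen U ∧ Literature.Topology.FourManifolds.MMSW.modelHandlebody 0 ⊆ U ∧ ContMDiffOn (𝓡 4) (𝓡 4) ((⊤ : ℕ∞) : WithTop ℕ∞) i U ∧ Set.InjOn i U ∧ (∀ x ∈ U, Function.Injective (mfderiv (𝓡 4) (𝓡 4) i x))) → ∃ (ε : Fin 0 → ℤ) (e : EuclideanSpace ℝ (Fin 4) → X), Manifold.IsSmoothEmbedding (𝓡 4) (𝓡 4) ((⊤ : ℕ∞) : WithTop ℕ∞) e ∧ ∀ x ∈ Literature.Topology.FourManifolds.MMSW.modelHandlebody 0, e (Literature.Topology.FourManifolds.MMSW.fibreRot (fun z : ℂ =>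 ∏ j : Fin 0, ((z - Literature.Topology.FourManifolds.MMSW.holeCentre 0 j) / (((‖z - Literature.Topology.FourManifolds.MMSW.holeCentre 0 j‖ : ℝ)) : ℂ)) ^ (ε j)) x) = i x := by
  intro X _ _ _ _ _ _ U i h
  obtain ⟨hU, hDU, hi, hinj, hd⟩ := h
  obtain ⟨A, hA⟩ := handlebodyChart_exists_scaling
  -- `A` carries `D_0` into the closed unit ball and `A⁻¹` carries the closed unit ball into `D_0`
  have hAle : ∀ x ∈ modelHandlebody 0, ‖A x‖ ≤ 1 := fun x hx => by
    have h : ‖A x‖ ^ 2 ≤ 1 := by rw [hA]; exact hx.2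
    nlinarith [norm_nonneg (A x)]
  have hAmem : ∀ y : EuclideanSpace ℝ (Fin 4), ‖y‖ ≤ 1 → A.symm y ∈ modelHandlebody 0 := fun y hy => by
    refine ⟨fun j => j.elim0, ?_⟩
    show levelFun 0 (A.symm y) ≤ 1
    rw [← hA, A.apply_symm_apply]
    nlinarith [norm_nonneg y]
  -- Step 1: a radius `R = δ + 1 > 1` with `A⁻¹ (B(0, R)) ⊆ U`
  have hU' : IsOpen (A.symm ⁻¹' U) := hU.preimage A.symm.continuous
  have hsub : closedBall (0 : EuclideanSpace ℝ (Fin 4)) 1 ⊆ A.symm ⁻¹' U :=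
    fun y hy => hDU (hAmem y (mem_closedBall_zero_iff.1 hy))
  obtain ⟨δ, hδ, hthick⟩ :=
    (isCompact_closedBall (0 : EuclideanSpace ℝ (Fin 4)) 1).exists_thickening_subset_open hU' hsub
  rw [thickening_closedBall hδ zero_le_one] at hthick
  have hR1 : 1 < δ + 1 := by linarith
  have hRU : ∀ y : EuclideanSpace ℝ (Fin 4), ‖y‖ < δ + 1 → A.symm y ∈ U :=
    fun y hy => hthick (mem_ball_zero_iff.2 hy)
  -- Step 2: the reparametrisation `ψ = A⁻¹ ∘ ballStretch R ∘ A` of `ℝ⁴` onto `A⁻¹ (B(0, R))`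
  set ψ : EuclideanSpace ℝ (Fin 4) → EuclideanSpace ℝ (Fin 4) := ⇑A.symm ∘ ballStretch (δ + 1) ∘ ⇑A
    with hψ
  have hψU : ∀ x, ψ x ∈ U := fun x => hRU _ (norm_ballStretch_lt hR1 _)
  have hψD : ∀ x ∈ modelHandlebody 0, ψ x = x := fun x hx => by
    show A.symm (ballStretch (δ + 1) (A x)) = x
    rw [ballStretch_eq_self hR1 (hAle x hx), A.symm_apply_apply]
  have hψs : ContDiff ℝ ∞ ψ :=
    (A.symm : EuclideanSpace ℝ (Fin 4) →L[ℝ] EuclideanSpace ℝ (Fin 4)).contDiff.comp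
      ((contDiff_ballStretch hR1).comp (A : EuclideanSpace ℝ (Fin 4) →L[ℝ] EuclideanSpace ℝ (Fin 4)).contDiff)
  have hψinj : Injective ψ := A.symm.injective.comp ((injective_ballStretch hR1).comp A.injective)
  have hψd : ∀ x, Injective (fderiv ℝ ψ x) := fun x => by
    have h1 : fderiv ℝ ψ x = (A.symm : EuclideanSpace ℝ (Fin 4) →L[ℝ] EuclideanSpace ℝ (Fin 4)).comp
        (fderiv ℝ (ballStretch (δ + 1) ∘ ⇑A) x) :=
      A.symm.comp_fderiv
    have h2 : fderiv ℝ (ballStretch (δ + 1) ∘ ⇑A) x =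
        (fderiv ℝ (ballStretch (δ + 1)) (A x)).comp (A : EuclideanSpace ℝ (Fin 4) →L[ℝ] EuclideanSpace ℝ (Fin 4)) :=
      A.comp_right_fderiv
    rw [h1, h2]
    exact A.symm.injective.comp ((injective_fderiv_ballStretch hR1 _).comp A.injective)
  -- Step 3: the global chart `e = i ∘ ψ`
  have hψm : ContMDiff (𝓡 4) (𝓡 4) ∞ ψ := hψs.contMDiff
  have hem : ContMDiff (𝓡 4) (𝓡 4) ∞ (i ∘ ψ) := hi.comp_contMDiff hψm hψU
  have heinj : Injective (i ∘ ψ) := fun x y hxy => hψinj (hinj (hψU x) (hψU y) hxy)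
  have hn : (∞ : WithTop ℕ∞) ≠ 0 := by simp
  have hed : ∀ x, Injective (mfderiv (𝓡 4) (𝓡 4) (i ∘ ψ) x) := fun x => by
    have h1 : MDifferentiableAt (𝓡 4) (𝓡 4) i (ψ x) :=
      (hi.contMDiffAt (hU.mem_nhds (hψU x))).mdifferentiableAt hn
    have h2 : MDifferentiableAt (𝓡 4) (𝓡 4) ψ x := (hψm x).mdifferentiableAt hn
    rw [mfderiv_comp x h1 h2]
    have h3 : mfderiv (𝓡 4) (𝓡 4) ψ x = fderiv ℝ ψ x := mfderiv_eq_fderiv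
    rw [h3]
    exact (hd _ (hψU x)).comp (hψd x)
  have hloc : IsLocalDiffeomorph (𝓡 4) (𝓡 4) ∞ (i ∘ ψ) := fun x =>
    isLocalDiffeomorphAt_of_mfderiv_injective isOpen_univ (mem_univ x) hem.contMDiffOn
      (by exact_mod_cast le_top) rfl (hed x)
  have hemb : Manifold.IsSmoothEmbedding (𝓡 4) (𝓡 4) ∞ (i ∘ ψ) :=
    isSmoothEmbedding_of_isLocalDiffeomorph hloc heinj (ContinuousLinearEquiv.refl ℝ _)
  refine ⟨fun _ => 0, i ∘ ψ, hemb, fun x hx => ?_⟩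
  -- the twist over `Fin 0` is the identity (empty product of multipliers)
  have hfix : fibreRot (fun z : ℂ => ∏ j : Fin 0, ((z - holeCentre 0 j) /
      (((‖z - holeCentre 0 j‖ : ℝ)) : ℂ)) ^ ((fun _ : Fin 0 => (0 : ℤ)) j)) x = x :=
    fibreRot_of_apply_eq_one (by simp)
  rw [hfix]
  exact congrArg i (hψD x hx)

end Summit.SmoothPoincare4.SmoothPoincare4.Theorems.DcrGap.MkFriends

end
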